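import Mathlib
import HarnessLib

/-!
# Divisors of the values of a pair of linear forms: congruence classes after a divisor switch

Topic `Literature/NumberTheory/Sieve`; everything in this file is PROVED and elementary.  For two
integral linear forms `P(n) = q₀ n + a₀`, `R(n) = q₁ n + a₁` (`q₁ ≥ 1`, `gcd(q₁, a₁) = 1`,
determinant `Δ = q₁ a₀ - q₀ a₁ ≠ 0`), a divisor `d ∣ P(n)` and a factorisation `R(n) = b m`, the
"divisor switch" trades the long variable `n` for the complementary divisor `b`; this file records
what the conditions on `n` become in terms of `b` (the bookkeeping behind level-of-distribution
arguments for linear forms, Iwaniec–Kowalski §17.3; Friedlander–Iwaniec, *Opera de Cribro*, §22.2):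

* `exists_dvd_and_mul_eq_iff` — `∃ n ∈ [n₁, x], d ∣ P(n), b m = R(n)` iff
  `R(n₁) ≤ b m ≤ R(x)`, `b m ≡ a₁ (q₁)` and `q₀ m b ≡ -Δ (q₁ d)`;
* `congr_cond_iff_mod` — these congruences only depend on `b (mod q₁ d)`;
* `card_filter_linear_congr_le` — a congruence `A c + B ≡ 0 (mod L)` with `B ≠ 0` has at most
  `|B|` solutions `c (mod L)`; hence `card_filter_congr_cond_le`: at most `|Δ|` classes of `b`;
* `gcd_dvd_and_coprime_of_congr_cond` — for such a class `c` and squarefree `d`,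
  `g = gcd(c, q₁ d)` divides `Δ` and is a unitary divisor of `q₁ d` (the shape required by
  `Literature.NumberTheory.Sieve.BVMoebius.exists_abs_sum_moebius_congr_le`);
* `exists_eq_Ioc_of_ordConnected`, `sum_filter_periodic_eq` — a finite order-convex set of
  positive integers is an interval `(N', N]`; a sum over an `L`-periodic condition splits into
  residue classes.

## References

* H. Iwaniec, E. Kowalski, *Analytic Number Theory*, AMS Colloquium Publ. 53 (2004), §17.3.
  [IwaniecKowalski2004]
-/

namespace Literature.NumberTheory.Sieve

namespace LinearFormPair

open Finset

/-! ### The switch: conditions on `n` as conditions on `b` -/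

/-- **Divisors of the values of two linear forms ↔ congruences.**  Let `P(n) = q₀ n + a₀`,
`R(n) = q₁ n + a₁` (`q₁ ≥ 1`) be positive at `n₁`.  For naturals `d, m, b` and `x`:
there is `n ∈ [n₁, x]` with `d ∣ P(n)` and `b m = R(n)` iff `R(n₁) ≤ b m ≤ R(x)`,
`b m ≡ a₁ (mod q₁)` and `q₀ m · b ≡ -(q₁ a₀ - q₀ a₁) (mod q₁ d)` — the last congruence is
`q₁ d ∣ q₁ P(n)` written in terms of `b m = R(n)`. [folklore] -/
theorem exists_dvd_and_mul_eq_iff {q₀ q₁ : ℕ} (hq₁ : 0 < q₁) {a₀ a₁ : ℤ} {n₁ : ℕ}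
    (hP : 0 < (q₀ : ℤ) * n₁ + a₀) (hR : 0 < (q₁ : ℤ) * n₁ + a₁) (d m b x : ℕ) :
    (∃ n : ℕ, n₁ ≤ n ∧ n ≤ x ∧ d ∣ ((q₀ : ℤ) * n + a₀).toNat ∧
        b * m = ((q₁ : ℤ) * n + a₁).toNat) ↔
      ((q₁ : ℤ) * n₁ + a₁ ≤ (b : ℤ) * m ∧ (b : ℤ) * m ≤ (q₁ : ℤ) * x + a₁ ∧
        (q₁ : ℤ) ∣ (b : ℤ) * m - a₁ ∧
        (q₁ : ℤ) * d ∣ (q₀ : ℤ) * m * b + ((q₁ : ℤ) * a₀ - (q₀ : ℤ) * a₁)) := by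
  have hq₁z : (0 : ℤ) < q₁ := by exact_mod_cast hq₁
  have hmonoP : ∀ n : ℕ, n₁ ≤ n → 0 < (q₀ : ℤ) * n + a₀ := by
    intro n hn
    have : (q₀ : ℤ) * n₁ ≤ (q₀ : ℤ) * n :=
      mul_le_mul_of_nonneg_left (by exact_mod_cast hn) (by positivity)
    linarith
  have hmonoR : ∀ n : ℕ, n₁ ≤ n → 0 < (q₁ : ℤ) * n + a₁ := by
    intro n hn
    have : (q₁ : ℤ) * n₁ ≤ (q₁ : ℤ) * n :=
      mul_le_mul_of_nonneg_left (by exact_mod_cast hn) (by positivity)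
    linarith
  constructor
  · rintro ⟨n, hn₁, hnx, hdP, hbm⟩
    have hPn := hmonoP n hn₁
    have hRn := hmonoR n hn₁
    have hbmz : (b : ℤ) * m = (q₁ : ℤ) * n + a₁ := by
      have : ((b * m : ℕ) : ℤ) = ((((q₁ : ℤ) * n + a₁).toNat : ℕ) : ℤ) := by rw [hbm]
      push_cast at this
      rw [this, Int.toNat_of_nonneg hRn.le]
    have hdPz : (d : ℤ) ∣ (q₀ : ℤ) * n + a₀ := by
      rw [← Int.toNat_of_nonneg hPn.le]
      exact Int.natCast_dvd_natCast.2 hdP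
    refine ⟨?_, ?_, ⟨n, by rw [hbmz]; ring⟩, ?_⟩
    · rw [hbmz]
      have : (q₁ : ℤ) * n₁ ≤ (q₁ : ℤ) * n :=
        mul_le_mul_of_nonneg_left (by exact_mod_cast hn₁) hq₁z.le
      linarith
    · rw [hbmz]
      have : (q₁ : ℤ) * n ≤ (q₁ : ℤ) * x :=
        mul_le_mul_of_nonneg_left (by exact_mod_cast hnx) hq₁z.le
      linarith
    · have e : (q₀ : ℤ) * m * b + ((q₁ : ℤ) * a₀ - (q₀ : ℤ) * a₁) =
          (q₁ : ℤ) * ((q₀ : ℤ) * n + a₀) := by linear_combination (q₀ : ℤ) * hbmz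
      rw [e]
      exact mul_dvd_mul_left _ hdPz
  · rintro ⟨hlo, hhi, ⟨k, hk⟩, hdvd⟩
    -- `b m = q₁ k + a₁` with `n₁ ≤ k ≤ x`
    have hbmz : (b : ℤ) * m = (q₁ : ℤ) * k + a₁ := by linarith
    have hk₁ : (n₁ : ℤ) ≤ k := by
      by_contra h
      push Not at h
      have : (q₁ : ℤ) * k + (q₁ : ℤ) ≤ (q₁ : ℤ) * n₁ := by
        have := mul_le_mul_of_nonneg_left (show k + 1 ≤ (n₁ : ℤ) by omega) hq₁z.le
        linarith
      linarith
    have hkx : k ≤ (x : ℤ) := by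
      by_contra h
      push Not at h
      have : (q₁ : ℤ) * x + (q₁ : ℤ) ≤ (q₁ : ℤ) * k := by
        have := mul_le_mul_of_nonneg_left (show (x : ℤ) + 1 ≤ k by omega) hq₁z.le
        linarith
      linarith
    have hk0 : 0 ≤ k := le_trans (by positivity) hk₁
    obtain ⟨n, rfl⟩ : ∃ n : ℕ, (n : ℤ) = k := ⟨k.toNat, Int.toNat_of_nonneg hk0⟩
    have hn₁ : n₁ ≤ n := by exact_mod_cast hk₁
    have hnx : n ≤ x := by exact_mod_cast hkx
    have hPn := hmonoP n hn₁
    have hRn := hmonoR n hn₁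
    refine ⟨n, hn₁, hnx, ?_, ?_⟩
    · have e : (q₀ : ℤ) * m * b + ((q₁ : ℤ) * a₀ - (q₀ : ℤ) * a₁) =
          (q₁ : ℤ) * ((q₀ : ℤ) * n + a₀) := by linear_combination (q₀ : ℤ) * hbmz
      rw [e] at hdvd
      have hdPz : (d : ℤ) ∣ (q₀ : ℤ) * n + a₀ := (mul_dvd_mul_iff_left hq₁z.ne').1 hdvd
      rw [← Int.toNat_of_nonneg hPn.le] at hdPz
      exact Int.natCast_dvd_natCast.1 hdPz
    · have : ((b * m : ℕ) : ℤ) = ((((q₁ : ℤ) * n + a₁).toNat : ℕ) : ℤ) := by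
        push_cast
        rw [hbmz, Int.toNat_of_nonneg hRn.le]
      exact_mod_cast this

/-- The congruence conditions of `exists_dvd_and_mul_eq_iff` only depend on `b` modulo `q₁ d`.
[folklore] -/
theorem congr_cond_iff_mod (q₀ q₁ d m : ℕ) (a₁ Δ : ℤ) (b : ℕ) :
    ((q₁ : ℤ) ∣ (b : ℤ) * m - a₁ ∧ (q₁ : ℤ) * d ∣ (q₀ : ℤ) * m * b + Δ) ↔
      ((q₁ : ℤ) ∣ ((b % (q₁ * d) : ℕ) : ℤ) * m - a₁ ∧
        (q₁ : ℤ) * d ∣ (q₀ : ℤ) * m * ((b % (q₁ * d) : ℕ) : ℤ) + Δ) := by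
  set L := q₁ * d with hL
  have hb : (b : ℤ) = ((b % L : ℕ) : ℤ) + (L : ℤ) * ((b / L : ℕ) : ℤ) := by
    have := Nat.mod_add_div b L
    exact_mod_cast this.symm
  have hLz : (L : ℤ) = (q₁ : ℤ) * d := by rw [hL]; push_cast; ring
  constructor
  · rintro ⟨h1, h2⟩
    refine ⟨?_, ?_⟩
    · have e : ((b % L : ℕ) : ℤ) * m - a₁ =
          ((b : ℤ) * m - a₁) - (q₁ : ℤ) * (d * ((b / L : ℕ) : ℤ) * m) := by
        rw [hb, hLz]; ring
      rw [e]
      exact dvd_sub h1 (dvd_mul_right _ _)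
    · have e : (q₀ : ℤ) * m * ((b % L : ℕ) : ℤ) + Δ =
          ((q₀ : ℤ) * m * b + Δ) - (q₁ : ℤ) * d * ((q₀ : ℤ) * m * ((b / L : ℕ) : ℤ)) := by
        rw [hb, hLz]; ring
      rw [e]
      exact dvd_sub h2 (dvd_mul_right _ _)
  · rintro ⟨h1, h2⟩
    refine ⟨?_, ?_⟩
    · have e : (b : ℤ) * m - a₁ =
          (((b % L : ℕ) : ℤ) * m - a₁) + (q₁ : ℤ) * (d * ((b / L : ℕ) : ℤ) * m) := by
        rw [hb, hLz]; ring
      rw [e]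
      exact dvd_add h1 (dvd_mul_right _ _)
    · have e : (q₀ : ℤ) * m * b + Δ =
          ((q₀ : ℤ) * m * ((b % L : ℕ) : ℤ) + Δ) + (q₁ : ℤ) * d * ((q₀ : ℤ) * m * ((b / L : ℕ) : ℤ)) := by
        rw [hb, hLz]; ring
      rw [e]
      exact dvd_add h2 (dvd_mul_right _ _)

/-! ### Counting the classes -/

/-- **Solutions of a linear congruence.** For `L ≥ 1`, `A ∈ ℤ` and `B ≠ 0` the congruence
`A c + B ≡ 0 (mod L)` has at most `|B|` solutions `0 ≤ c < L`: two solutions differ by a multiple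
of `L / gcd(A, L)`, so there are at most `gcd(A, L)` of them, and a solution forces
`gcd(A, L) ∣ B`. [folklore] -/
theorem card_filter_linear_congr_le {L : ℕ} (hL : 0 < L) (A : ℤ) {B : ℤ} (hB : B ≠ 0) :
    #((range L).filter (fun c : ℕ => (L : ℤ) ∣ A * c + B)) ≤ B.natAbs := by
  set S := (range L).filter (fun c : ℕ => (L : ℤ) ∣ A * c + B) with hSdef
  rcases S.eq_empty_or_nonempty with h | ⟨c₀, hc₀⟩
  · rw [h, card_empty]; exact Nat.zero_le _
  have hc₀S : (L : ℤ) ∣ A * c₀ + B := (mem_filter.1 hc₀).2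
  set g : ℕ := Int.gcd A L with hgdef
  have hLz : (L : ℤ) ≠ 0 := by exact_mod_cast hL.ne'
  have hg0 : 0 < g := Int.gcd_pos_of_ne_zero_right _ hLz
  have hgA : (g : ℤ) ∣ A := Int.gcd_dvd_left A L
  have hgL : (g : ℤ) ∣ (L : ℤ) := Int.gcd_dvd_right A L
  -- `g ∣ B`, so `g ≤ |B|`
  have hgB : g ≤ B.natAbs := by
    have h1 : (g : ℤ) ∣ A * c₀ + B := hgL.trans hc₀S
    have h2 : (g : ℤ) ∣ B := (Int.dvd_add_right (hgA.mul_right _)).1 h1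
    exact Nat.le_of_dvd (Int.natAbs_pos.2 hB) (Int.natCast_dvd.1 h2)
  -- `L = g L'`, `A = g A'`, `gcd(A', L') = 1`
  obtain ⟨L', hL'⟩ : g ∣ L := Int.natCast_dvd_natCast.1 hgL
  obtain ⟨A', hA'⟩ := hgA
  have hL'0 : 0 < L' := by
    rcases Nat.eq_zero_or_pos L' with h | h
    · rw [h, mul_zero] at hL'; omega
    · exact h
  have hcop : IsCoprime (L' : ℤ) A' := by
    rw [Int.isCoprime_iff_gcd_eq_one, Int.gcd_comm]
    have h := Int.gcd_div_gcd_div_gcd (i := A) (j := (L : ℤ)) hg0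
    rw [← hgdef] at h
    have e1 : A / (g : ℤ) = A' := by
      rw [hA', Int.mul_ediv_cancel_left _ (by exact_mod_cast hg0.ne')]
    have e2 : (L : ℤ) / (g : ℤ) = (L' : ℤ) := by
      rw [hL']; push_cast; rw [Int.mul_ediv_cancel_left _ (by exact_mod_cast hg0.ne')]
    rwa [e1, e2] at h
  -- all solutions are congruent modulo `L'`
  have hcong : ∀ c ∈ S, c ≡ c₀ [MOD L'] := by
    intro c hc
    have hcS : (L : ℤ) ∣ A * c + B := (mem_filter.1 hc).2
    have h1 : (L : ℤ) ∣ A * ((c : ℤ) - c₀) := by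
      have := dvd_sub hcS hc₀S
      rwa [show A * (c : ℤ) + B - (A * (c₀ : ℤ) + B) = A * ((c : ℤ) - c₀) by ring] at this
    have hLgL' : ((L : ℕ) : ℤ) = (g : ℤ) * L' := by rw [hL']; push_cast; rfl
    rw [hLgL', hA', mul_assoc] at h1
    have h2 : (L' : ℤ) ∣ A' * ((c : ℤ) - c₀) :=
      (mul_dvd_mul_iff_left (by exact_mod_cast hg0.ne' : (g : ℤ) ≠ 0)).1 h1
    have h3 : (L' : ℤ) ∣ (c : ℤ) - c₀ := hcop.dvd_of_dvd_mul_left h2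
    rw [Nat.modEq_iff_dvd]
    have := h3.neg_right
    rwa [neg_sub] at this
  -- `c ↦ c / L'` injects the solutions into `range g`
  calc #S ≤ #(range g) := by
        refine card_le_card_of_injOn (fun c => c / L') (fun c hc => ?_) ?_
        · rw [Finset.mem_coe, hSdef, mem_filter, mem_range] at hc
          rw [Finset.mem_coe, mem_range, Nat.div_lt_iff_lt_mul hL'0, ← hL']
          exact hc.1
        · intro c₁ hc₁ c₂ hc₂ h
          rw [Finset.mem_coe] at hc₁ hc₂
          have hmod : c₁ % L' = c₂ % L' := (hcong c₁ hc₁).trans (hcong c₂ hc₂).symm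
          calc c₁ = L' * (c₁ / L') + c₁ % L' := (Nat.div_add_mod c₁ L').symm
            _ = L' * (c₂ / L') + c₂ % L' := by rw [show c₁ / L' = c₂ / L' from h, hmod]
            _ = c₂ := Nat.div_add_mod c₂ L'
    _ = g := card_range g
    _ ≤ B.natAbs := hgB

/-- At most `|Δ|` classes `c (mod q₁ d)` satisfy the congruences of `exists_dvd_and_mul_eq_iff`
(`Δ = q₁ a₀ - q₀ a₁ ≠ 0`). [folklore] -/
theorem card_filter_congr_cond_le {q₀ q₁ d : ℕ} (hq₁ : 0 < q₁) (hd : 0 < d) (m : ℕ) (a₁ : ℤ)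
    {Δ : ℤ} (hΔ : Δ ≠ 0) :
    #((range (q₁ * d)).filter (fun c : ℕ =>
        (q₁ : ℤ) ∣ (c : ℤ) * m - a₁ ∧ (q₁ : ℤ) * d ∣ (q₀ : ℤ) * m * c + Δ)) ≤ Δ.natAbs := by
  have hL : 0 < q₁ * d := Nat.mul_pos hq₁ hd
  refine le_trans (card_le_card fun c hc => ?_)
    (card_filter_linear_congr_le hL ((q₀ : ℤ) * m) hΔ)
  rw [mem_filter] at hc ⊢
  refine ⟨hc.1, ?_⟩
  have h := hc.2.2
  push_cast
  exact h

/-- For a class `c` satisfying the congruences of `exists_dvd_and_mul_eq_iff`, with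
`gcd(q₁, a₁) = 1` and `d` squarefree, `g = gcd(c, q₁ d)` divides `Δ` and is a unitary divisor of
`q₁ d`: `g` is prime to `q₁` (from `c m ≡ a₁ (mod q₁)`), so `g ∣ d`, and `gcd(g, d/g) = 1`.
[folklore] -/
theorem gcd_dvd_and_coprime_of_congr_cond {q₀ q₁ d m c : ℕ} (hd : Squarefree d)
    {a₁ Δ : ℤ} (hcop : Int.gcd (q₁ : ℤ) a₁ = 1)
    (h1 : (q₁ : ℤ) ∣ (c : ℤ) * m - a₁) (h2 : (q₁ : ℤ) * d ∣ (q₀ : ℤ) * m * c + Δ) :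
    Nat.gcd c (q₁ * d) ∣ Δ.natAbs ∧ (Nat.gcd c (q₁ * d)).Coprime (q₁ * d / Nat.gcd c (q₁ * d)) := by
  set g := Nat.gcd c (q₁ * d) with hgdef
  have hgc : g ∣ c := Nat.gcd_dvd_left _ _
  have hgL : g ∣ q₁ * d := Nat.gcd_dvd_right _ _
  -- `g ∣ Δ`
  have hgΔ : (g : ℤ) ∣ Δ := by
    have hA : (g : ℤ) ∣ (q₀ : ℤ) * m * c := (Int.natCast_dvd_natCast.2 hgc).mul_left _
    have hB : (g : ℤ) ∣ (q₀ : ℤ) * m * c + Δ := by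
      refine dvd_trans ?_ h2
      have := Int.natCast_dvd_natCast.2 hgL
      push_cast at this
      exact this
    exact (Int.dvd_add_right hA).1 hB
  refine ⟨Int.natCast_dvd.1 hgΔ, ?_⟩
  -- `gcd(c, q₁) = 1`
  have hcq : Nat.Coprime c q₁ := by
    rw [Nat.Coprime]
    set e := Nat.gcd c q₁ with hedef
    have hec : (e : ℤ) ∣ (c : ℤ) * m := (Int.natCast_dvd_natCast.2 (Nat.gcd_dvd_left c q₁)).mul_right _
    have heq : (e : ℤ) ∣ (q₁ : ℤ) := Int.natCast_dvd_natCast.2 (Nat.gcd_dvd_right c q₁)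
    have hea : (e : ℤ) ∣ a₁ := by
      have : (e : ℤ) ∣ (c : ℤ) * m - a₁ := heq.trans h1
      have := (Int.dvd_iff_dvd_of_dvd_sub this).1 hec
      exact this
    have h1' : e ∣ Int.gcd (q₁ : ℤ) a₁ := by
      rw [Int.gcd_eq_natAbs, Int.natAbs_natCast]
      exact Nat.dvd_gcd (Nat.gcd_dvd_right c q₁) (Int.natCast_dvd.1 hea)
    rw [hcop] at h1'
    exact Nat.dvd_one.1 h1'
  have hgq : Nat.Coprime g q₁ := Nat.Coprime.coprime_dvd_left hgc hcq
  have hgd : g ∣ d := hgq.dvd_of_dvd_mul_left hgL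
  obtain ⟨d', hd'⟩ := hgd
  have hg0 : 0 < g := Nat.pos_of_ne_zero (by
    intro h0; rw [h0, zero_mul] at hd'; exact hd.ne_zero hd')
  have hcop' : Nat.Coprime g d' := by
    rw [hd'] at hd
    exact (Nat.squarefree_mul_iff.1 hd).1
  have hdiv : q₁ * d / g = q₁ * d' := by
    rw [hd', show q₁ * (g * d') = g * (q₁ * d') by ring, Nat.mul_div_cancel_left _ hg0]
  rw [hdiv]
  exact Nat.Coprime.mul_right hgq hcop'

/-! ### Intervals and periodic conditions -/

/-- A finite order-convex set of positive integers is an interval `(N', N]`, with `N` below every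
upper bound of the set. [folklore] -/
theorem exists_eq_Ioc_of_ordConnected (S : Finset ℕ) (h0 : 0 ∉ S)
    (hconv : ∀ a ∈ S, ∀ c ∈ S, ∀ b, a ≤ b → b ≤ c → b ∈ S) :
    ∃ N' N : ℕ, S = Ioc N' N ∧ ∀ u : ℕ, (∀ b ∈ S, b ≤ u) → N ≤ u := by
  rcases S.eq_empty_or_nonempty with h | hne
  · exact ⟨0, 0, by rw [h]; rfl, fun u _ => Nat.zero_le u⟩
  · have hmin : S.min' hne ≠ 0 := fun h => h0 (h ▸ S.min'_mem hne)
    refine ⟨S.min' hne - 1, S.max' hne, ?_, fun u hu => hu _ (S.max'_mem hne)⟩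
    ext b
    rw [mem_Ioc]
    constructor
    · intro hb
      have h1 := S.min'_le b hb
      have h2 := S.le_max' b hb
      omega
    · rintro ⟨h1, h2⟩
      exact hconv _ (S.min'_mem hne) _ (S.max'_mem hne) b (by omega) h2

/-- Splitting a sum over a periodic condition into residue classes: if `P(b)` only depends on
`b mod L`, then `∑_{b ∈ T, P(b)} f(b) = ∑_{c < L, P(c)} ∑_{b ∈ T, b ≡ c (L)} f(b)`. [folklore] -/
theorem sum_filter_periodic_eq {L : ℕ} (hL : 0 < L) (P : ℕ → Prop) [DecidablePred P]
    (hP : ∀ b, P b ↔ P (b % L)) (T : Finset ℕ) (f : ℕ → ℝ) :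
    ∑ b ∈ T.filter P, f b =
      ∑ c ∈ (range L).filter P, ∑ b ∈ T.filter (fun b : ℕ => b ≡ c [MOD L]), f b := by
  have hfib := (sum_fiberwise_of_maps_to (s := T.filter P) (t := range L) (g := fun b => b % L)
    (fun b _ => mem_range.2 (Nat.mod_lt _ hL)) f).symm
  have h1 : ∑ c ∈ (range L).filter P, ∑ b ∈ T.filter (fun b : ℕ => b ≡ c [MOD L]), f b =
      ∑ c ∈ range L, if P c then ∑ b ∈ T.filter (fun b : ℕ => b ≡ c [MOD L]), f b else 0 :=
    sum_filter _ _
  rw [h1, hfib]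
  refine sum_congr rfl fun c hc => ?_
  have hcL : c < L := mem_range.1 hc
  by_cases hPc : P c
  · rw [if_pos hPc]
    refine sum_congr ?_ fun _ _ => rfl
    ext b
    simp only [mem_filter, Nat.ModEq, Nat.mod_eq_of_lt hcL]
    constructor
    · rintro ⟨⟨hT, _⟩, hbc⟩; exact ⟨hT, hbc⟩
    · rintro ⟨hT, hbc⟩; exact ⟨⟨hT, (hP b).2 (hbc ▸ hPc)⟩, hbc⟩
  · rw [if_neg hPc]
    refine sum_eq_zero fun b hb => ?_
    exfalso
    simp only [mem_filter] at hb
    exact hPc (hb.2 ▸ (hP b).1 hb.1.2)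

end LinearFormPair

end Literature.NumberTheory.Sieve
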